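import Summits.BirchSwinnertonDyer.Rank1Residual.Additive.QuadraticBranchEvenExactControlDischarge
import HarnessLib

/-!
# Route `QuadraticBranchSignedControl` (rung K8, cell `bsd-potss`), crux `PlusEtaLowerInclusion`
# (item stmt-BirchSwinnertonDyer-19601): the TAMAGAWA ROAD, part 1 — the RANK-FREE Cassels–Poitou–Tate
# bound `∏_{ℓ ∈ T} p^{ord_p c_ℓ(W)} ∣ #Sel^{loc,∞,+}(W/ℚ)[p^m]` for the `p*`-twist `W` of a good
# `a_p = 0` curve (seat `bsd-potss-k8eta-c1` g4)

WHAT. The valuation-squeeze road of this seat's g3 (p499967 … p507131) reduces (E⁺_η) at a tower-onto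
pair of ANY rank to ONE divisibility `p^v ∣ #(X_η/TX_η)_tors` (p505261), `X_η/TX_η` being Pontryagin
dual to the `Γ`-invariants `S^Γ` of `Sel⁺(V/K₀ℚ_∞)^η ≅ Sel⁺(W/ℚ_∞)`, and `S^Γ ≅ A₀⁺ =
Sel^{loc,∞,+}(W/ℚ)` (bottom-layer control, `h₀`). The successor task named in g3's memo
(HOME/k8eta-c1/MEMO-19601-r1-valuation-k8eta-c1-g3.md §D) is the TAMAGAWA ROAD: a LOWER bound for the
control defect from the Tamagawa numbers of `W` at `ℓ ≠ p` by Poitou–Tate. THIS FILE proves its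
`W`-coordinate half, RANK-FREE and at ONE finite level `p^m`:

* §1 (any number field `K`, any elliptic `E/K`, level `p^m`, `m ≥ 1`) `prod_relIndex_dvd_natCard_selmerGroup`:
  for a Selmer structure `𝓖 ⊇ 𝓚` on `E[p^m]` enlarging the Kummer structure `𝓚` at a finite set `T`
  of finite places and equal to it elsewhere, **`∏_{w ∈ T} [𝓖_w : 𝓚_w] ∣ #H¹_𝓖(K, E[p^m])`**.
  Proof: x1b's product form of Howard's Thm. 2.1.11 (`relIndex_selmerGroup_mul_relIndex_dual_eq_prod`:
  `[H¹_𝓖 : H¹_𝓚] · [H¹_{𝓚^*} : H¹_{𝓖^*}] = ∏ [𝓖_w : 𝓚_w]`), the dual index divides `#H¹_{𝓚^*}`,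
  and `#H¹_{𝓚^*} ∣ #H¹_𝓚` by X5's Weil transport + the self-duality of `𝓚`
  (`dualSelmerGroup_eq_map_selmerGroup_dualTransported`, `dualTransported_kummerSelmerStructure_eq`);
  Lagrange. NO hypothesis on the dual side (ctrl's rank-ZERO brick `relIndex_kummer_eq_prod_of_localization_eq_zero`
  needs every Kummer class locally trivial at `T`; here the dual side is simply bounded by `#Sel_{p^m}`).
* §2 (the `p*`-twist `W` of a globally minimal good `a_p = 0` curve `V`, `p` odd, `κ` cyclotomic)
  `prod_pow_padicValNat_localTamagawaNumber_dvd_natCard_localPreimage_inf_torsionBy`: GIVEN `hPT` and a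
  finite `T ∌ (p)` containing every `ℓ ≠ p` with `p ∣ c_ℓ(W)`, for every `m ≥ 1` with
  `ord_p c_ℓ(W) ≤ m` on `T`: **`∏_{ℓ ∈ T} p^{ord_p c_ℓ(W)} ∣ #{y ∈ Sel^{loc,∞,+}(W/ℚ) : p^m y = 0}`** —
  §1 for the tower structure `𝓣` refined at `v₀` (ctrl's `𝓖 = 𝓣[v₀ ↦ 𝓣_{v₀} ⊓ 𝓚_{v₀}]`, membership
  `c ∈ H¹_𝓖 ↔ Ψ_m c ∈ A₀⁺` by (L0⁺) = Kobayashi (9.33)), the level bridge `#H¹_𝓖 = #A₀⁺[p^m]`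
  (`Ψ_m` injective with image the `p^m`-torsion; NO finiteness of `A₀⁺`, which is INFINITE in
  positive rank), and x1b's local factors `[𝓣_ℓ : 𝓚_ℓ] = p^{ord_p c_ℓ}` (file 75, B4).

HONEST FRAMING (cell `bsd-potss`, run/shared/lean/pub/bsd-potss/; FULL-BSD rank ≤ 1 programme, HUMAN
RULING D-0036/D-0074): TOOL THEOREMS ONLY — no definition, no named Literature fact introduced (the ONE
fact-shaped input is `poitouTate_selmerStructure_duality_real K`, hypothesis `hPT`, exactly as ctrl /
x1b), no `sorry`, axioms standard. Nothing here mentions `η`, `X_η` or `L_p⁺`; the crux 19601 is NOT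
closed; nothing is booked; `BSD(W, p)` is claimed for no pair. `--supports stmt-BirchSwinnertonDyer-19601`.

References: [Howard2004HeegnerKolyvagin] Thm. 2.1.11; [MilneADT2006] I Thm. 2.8, Cor. 3.4, Thm. 4.10;
[GreenbergLNM1716] §3 Lemma 3.1–3.3 (pp. 85–90), §4 (pp. 98–103); [Kobayashi2003] Def. 2.1 (p. 5),
Thm. 9.3 with (9.33) (pp. 26–27); [SilvermanAEC2009] Prop. III.8.1, X.§4.
-/

set_option linter.dupNamespace false

noncomputable section

open scoped Classical

open CategoryTheory Field Function NumberField IsDedekindDomain WeierstrassCurve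
open Literature.NumberTheory.EllipticCurves
open Literature.NumberTheory.GaloisRepresentations
open Literature.NumberTheory.GaloisRepresentations.DiscreteGaloisModule (SelmerStructure)
open Literature.NumberTheory.GaloisCohomology
open Literature.NumberTheory.EllipticCurves.Kobayashi2003
open Summit.BirchSwinnertonDyer.Rank1Residual
open Summit.BirchSwinnertonDyer.Rank1Residual.X5.SelfDualCount
open Summit.BirchSwinnertonDyer.Rank1Residual.GaloisImage.CoreRankZero (selmerGroup_mono)
open Summit.BirchSwinnertonDyer.Rank1Residual.Additive.PoitouTateCountingProduct
open Summit.BirchSwinnertonDyer.Rank1Residual.X11b.Levels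
open Summit.BirchSwinnertonDyer.Rank1Residual.X11b
open Summit.BirchSwinnertonDyer.Rank1Residual.Additive
open Summit.BirchSwinnertonDyer.Rank1Residual.Additive.LevelBridge
open Summit.BirchSwinnertonDyer.Rank1Residual.Additive.RankZeroCount
open scoped ContRepresentation

namespace Summit.BirchSwinnertonDyer.BirchSwinnertonDyer.Theorems

namespace TamagawaRoad

/-! ## §1 The rank-free Cassels–Poitou–Tate bound `∏_{w ∈ T} [𝓖_w : 𝓚_w] ∣ #H¹_𝓖` -/

section Brick

variable {K : Type} [Field K] [NumberField K] (W : WeierstrassCurve K) [W.IsElliptic]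
  (p : ℕ) [hp : Fact p.Prime] (m : ℕ)

/-- **`∏_{w ∈ T} [𝓖_w : 𝓚_w] ∣ #H¹_𝓖(K, E[p^m])`** for a Selmer structure `𝓖` on `E[p^m]` (`m ≥ 1`)
with `𝓖_w ⊇ 𝓚_w` at `w ∈ T` (finite set of finite places) and `𝓖_v = 𝓚_v` elsewhere, `𝓚` the Kummer
structure, GRANTED `poitouTate_selmerStructure_duality_real K` (`hPT`). The product form of Howard's
Thm. 2.1.11 gives `[H¹_𝓖 : H¹_𝓚] · [H¹_{𝓚^*} : H¹_{𝓖^*}] = ∏_w [𝓖_w : 𝓚_w]`; the second factor divides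
`#H¹_{𝓚^*}(K, E[p^m]^D) = #w_*(H¹_𝓚) ∣ #H¹_𝓚` (Weil transport, self-duality of `𝓚`: Tate's local
Euler characteristic + the real places); and `[H¹_𝓖 : H¹_𝓚] · #H¹_𝓚 = #H¹_𝓖`. Rank-free: nothing is
asked of the Kummer classes. [cite: Howard2004HeegnerKolyvagin, Thm. 2.1.11 (arXiv:1202.6340 p. 6)]
[cite: MilneADT2006, I Thm. 4.10, Cor. 3.4, Thm. 2.8] [cite: GreenbergLNM1716, §4 (pp. 98–103)] -/
theorem prod_relIndex_dvd_natCard_selmerGroup (hm : 1 ≤ m)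
    (hPT : poitouTate_selmerStructure_duality_real K)
    (T : Finset (HeightOneSpectrum (𝓞 K)))
    (𝓖 : SelmerStructure (W.torsionGaloisModule ((p ^ m : ℕ) : ℤ)))
    (h𝓖T : ∀ w ∈ T, W.kummerSelmerStructure ((p ^ m : ℕ) : ℤ) (Sum.inr w) ≤ 𝓖 (Sum.inr w))
    (h𝓖off : ∀ v : Place K, (∀ w ∈ T, v ≠ Sum.inr w) →
      𝓖 v = W.kummerSelmerStructure ((p ^ m : ℕ) : ℤ) v) :
    ∏ w ∈ T, (W.kummerSelmerStructure ((p ^ m : ℕ) : ℤ) (Sum.inr w)).relIndex (𝓖 (Sum.inr w)) ∣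
      Nat.card 𝓖.selmerGroup := by
  haveI : NeZero (p ^ m) := ⟨pow_ne_zero m hp.out.ne_zero⟩
  have hpm : IsPrimePow (p ^ m) := (isPrimePow_nat_iff (p ^ m)).mpr ⟨p, m, hp.out, hm, rfl⟩
  haveI := finite_geomTorsion_of_neZero W (p ^ m)
  set 𝓚 : SelmerStructure (W.torsionGaloisModule ((p ^ m : ℕ) : ℤ)) :=
    W.kummerSelmerStructure ((p ^ m : ℕ) : ℤ) with h𝓚def
  -- the Poitou–Tate family from `hPT`, Tate's local Euler characteristic (a tree THEOREM), a Weil pairing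
  obtain ⟨inv, hperf, hvan, -, hcomp, hreal⟩ := exists_localInvariants_injective_inl_of_real hPT (p ^ m)
  have hEP : ∀ v : HeightOneSpectrum (𝓞 K), localEulerPoincareCharacteristic (v.adicCompletion K) :=
    fun v ↦ by
      haveI : CharZero (v.adicCompletion K) := charZero_adicCompletion v
      exact localEulerPoincareCharacteristic_holds (v.adicCompletion K)
  obtain ⟨e, hμ, hadd₁, hadd₂, halt, hnondeg, hgal⟩ := exists_weilPairing_holds W (p ^ m)
    (hp.out.two_le.trans (Nat.le_self_pow (by omega) p)) (Nat.cast_ne_zero.mpr (NeZero.ne (p ^ m)))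
  -- the exceptional set `S ⊇ T ∪ ∞ ∪ {v ∣ p} ∪ bad`
  obtain ⟨S, hTS, hinf, hpS, hbad⟩ :=
    X11b.KummerPT.exists_exceptional_finset W p (T.image (fun w ↦ (Sum.inr w : Place K)))
  have hT : ∀ w ∈ T, (Sum.inr w : Place K) ∈ S := fun w hw ↦ hTS (Finset.mem_image_of_mem _ hw)
  have hS : ∀ v : HeightOneSpectrum (𝓞 K), (Sum.inr v : Place K) ∉ S →
      (((p ^ m : ℕ) : ℕ) : 𝓞 K) ∉ v.asIdeal ∧
        GaloisRep.IsUnramifiedAt v (W.torsionGaloisModule ((p ^ m : ℕ) : ℤ)) := fun v hv ↦ by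
    have hpv : ((p : ℕ) : 𝓞 K) ∉ v.asIdeal := fun h ↦ hv (hpS v h)
    have hgood : W.HasGoodReductionAt v := by_contra fun h ↦ hv (hbad v h)
    have hpkv : ((p ^ m : ℕ) : 𝓞 K) ∉ v.asIdeal := by
      rw [Nat.cast_pow]
      exact fun h ↦ hpv (v.isPrime.mem_of_pow_mem m h)
    exact ⟨hpkv, X11b.AcSelmer.isUnramifiedAt_torsionGaloisModule W hgood
      (by rw [Int.cast_natCast]; exact hpkv)⟩
  have h𝓚 : SelmerStructure.IsUnramifiedOutside 𝓚 S :=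
    X11b.KummerDuality.kummerSelmerStructure_isUnramifiedOutside W p m S hinf hpS hbad
  -- `𝓚 ≤ 𝓖`, `𝓖` unramified outside `S`, they agree off `T`
  have hmemT : ∀ v : Place K, (¬ ∃ w ∈ T, v = Sum.inr w) → ∀ w ∈ T, v ≠ Sum.inr w :=
    fun v hv w hw h ↦ hv ⟨w, hw, h⟩
  have hle : 𝓚 ≤ 𝓖 := fun v ↦ by
    by_cases hv : ∃ w ∈ T, v = Sum.inr w
    · obtain ⟨w, hw, rfl⟩ := hv
      exact h𝓖T w hw
    · rw [h𝓖off v (hmemT v hv)]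
  have hdiff : ∀ v : Place K, (∀ w ∈ T, v ≠ Sum.inr w) → 𝓚 v = 𝓖 v := fun v hv ↦ (h𝓖off v hv).symm
  have h𝓖S : 𝓖.IsUnramifiedOutside S := by
    refine ⟨h𝓚.1, fun v hv ↦ ?_⟩
    rw [h𝓖off (Sum.inr v) (fun w hw h ↦ hv (h ▸ hT w hw))]
    exact h𝓚.2 v hv
  have hM : ∀ P : geomTorsion W ((p ^ m : ℕ) : ℤ), (p ^ m) • P = 0 := fun P ↦ AddSubgroup.torsionBy.nsmul P
  -- the product form of Howard's Thm. 2.1.11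
  have hprod := relIndex_selmerGroup_mul_relIndex_dual_eq_prod hperf hvan hcomp hM hS T hT hle h𝓖S hdiff
  -- residual self-duality of `𝓚` and the Weil transport: `#H¹_{𝓚^*} ∣ #H¹_𝓚`
  have hsd : inv.dualTransported 𝓚 (weilDualIntertwining W (p ^ m) e hμ hadd₁ hadd₂ hgal) = 𝓚 :=
    funext fun v ↦ dualTransported_kummerSelmerStructure_eq W (p ^ m) e hμ hadd₁ hadd₂ hgal halt hnondeg
      inv hpm hperf hEP hreal v
  have hdualcard : Nat.card (inv.dualSelmerStructure (W.torsionGaloisModule ((p ^ m : ℕ) : ℤ)) 𝓚).selmerGroup ∣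
      Nat.card 𝓚.selmerGroup := by
    rw [dualSelmerGroup_eq_map_selmerGroup_dualTransported W (p ^ m) e hμ hadd₁ hadd₂ hgal hnondeg inv 𝓚,
      hsd]
    exact AddSubgroup.card_map_dvd _ _
  -- the dual index divides `#H¹_{𝓚^*}`
  have hD : (inv.dualSelmerStructure (W.torsionGaloisModule ((p ^ m : ℕ) : ℤ)) 𝓖).selmerGroup.relIndex
      (inv.dualSelmerStructure (W.torsionGaloisModule ((p ^ m : ℕ) : ℤ)) 𝓚).selmerGroup ∣
      Nat.card 𝓚.selmerGroup :=
    (AddSubgroup.relIndex_dvd_card _ _).trans hdualcard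
  -- Lagrange: `[H¹_𝓖 : H¹_𝓚] · #H¹_𝓚 = #H¹_𝓖`
  have hlag : 𝓚.selmerGroup.relIndex 𝓖.selmerGroup * Nat.card 𝓚.selmerGroup = Nat.card 𝓖.selmerGroup := by
    have h1 : Nat.card (𝓚.selmerGroup.addSubgroupOf 𝓖.selmerGroup) = Nat.card 𝓚.selmerGroup :=
      Nat.card_congr (AddSubgroup.addSubgroupOfEquivOfLe (selmerGroup_mono hle)).toEquiv
    rw [AddSubgroup.relIndex, mul_comm, ← h1]
    exact AddSubgroup.card_mul_index _
  rw [← hprod, ← hlag]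
  exact mul_dvd_mul_left _ hD

end Brick

/-! ## §2 The `p*`-twist: `∏_{ℓ ∈ T} p^{ord_p c_ℓ(W)} ∣ #Sel^{loc,∞,+}(W/ℚ)[p^m]` -/

section Twist

variable (W : WeierstrassCurve ℚ) [W.IsElliptic] [W.IsGloballyMinimal] (p : ℕ) [hp : Fact p.Prime]
  (κ : ZpExtension ℚ p) (m : ℕ)

/-- **`∏_{ℓ ∈ T} p^{ord_p c_ℓ(W)} ∣ #Sel^{loc,∞,+}(W/ℚ)[p^m]` — the rank-free Tamagawa lower bound for
the bottom-layer plus control defect at ONE finite level.** For the odd prime `p`, `W/ℚ` with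
`Cv • W.quadraticTwist ((−1)^{p/2} p) = V`, `V` globally minimal with good reduction at `p` and
`a_p(V) = 0`, `κ` the cyclotomic `ℤ_p`-extension, GRANTED `hPT`; `T ∌ v₀ = (p)` a finite set of places
containing every `ℓ ≠ p` with `p ∣ c_ℓ(W)`, and a level `m ≥ 1` with `ord_p c_ℓ(W) ≤ m` for `ℓ ∈ T`.
With `A₀⁺ = Sel^{loc,∞,+}(W/ℚ)` (the classes over `ℚ` restricting into `Sel_{p^∞}(W/ℚ_∞)` and into the
level-`∞` plus Kummer condition at every conjugate of the embedding at `p`; ctrl's B2 form):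
**`∏_{ℓ ∈ T} p^{ord_p c_ℓ(W)}` divides the order of the `p^m`-torsion subgroup `A₀⁺[p^m]`.** §1 for
ctrl's refined tower structure `𝓖 = 𝓣[v₀ ↦ 𝓣_{v₀} ⊓ 𝓚_{v₀}]` (membership `c ∈ H¹_𝓖 ↔ Ψ_m c ∈ A₀⁺` by
(L0⁺), Kobayashi (9.33)), the bridge `#H¹_𝓖 = #A₀⁺[p^m]` (`Ψ_m` injective — `W(ℚ_∞)[p^∞] = 0`, x1b
file 55 — with image the `p^m`-torsion), and the local factors `[𝓣_ℓ : 𝓚_ℓ] = p^{ord_p c_ℓ}` (x1b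
file 75, B4). NO finiteness of `A₀⁺` (infinite in positive rank). CONDITIONAL on `hPT`; nothing booked.
[cite: GreenbergLNM1716, §3 Lemma 3.1–3.3 (pp. 85–90), §4 (pp. 98–103)]
[cite: Kobayashi2003, Thm. 9.3 with (9.33) (pp. 26–27)] [cite: MilneADT2006, Ch. I, Thm. 4.10]
[cite: Howard2004HeegnerKolyvagin, Thm. 2.1.11 (arXiv:1202.6340 p. 6)] -/
theorem prod_pow_padicValNat_localTamagawaNumber_dvd_natCard_localPreimage_inf_torsionBy
    (hm : 1 ≤ m) (hp2 : p ≠ 2) (hκ : κ.IsCyclotomic) (Cv : VariableChange ℚ) (V : WeierstrassCurve ℚ)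
    [V.IsElliptic] [V.IsGloballyMinimal] (hCV : Cv • W.quadraticTwist ((-1) ^ (p / 2) * p) = V)
    (hgood : V.HasGoodReductionAtPrime p) (hap : V.frobeniusTrace p = 0)
    (hPT : poitouTate_selmerStructure_duality_real ℚ)
    (T : Finset (HeightOneSpectrum (𝓞 ℚ)))
    (hpT : (Rat.HeightOneSpectrum.primesEquiv (R := 𝓞 ℚ)).symm ⟨p, hp.out⟩ ∉ T)
    (hT : ∀ v : HeightOneSpectrum (𝓞 ℚ), v ≠ (Rat.HeightOneSpectrum.primesEquiv (R := 𝓞 ℚ)).symm ⟨p, hp.out⟩ →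
      p ∣ (W.baseChange (v.adicCompletion ℚ)).localTamagawaNumber (v.adicCompletionIntegers ℚ) → v ∈ T)
    (hTm : ∀ w ∈ T, padicValNat p ((W.baseChange (w.adicCompletion ℚ)).localTamagawaNumber
      (w.adicCompletionIntegers ℚ)) ≤ m) :
    ∏ w ∈ T, p ^ padicValNat p ((W.baseChange (w.adicCompletion ℚ)).localTamagawaNumber
        (w.adicCompletionIntegers ℚ)) ∣
      Nat.card ↥((W.selmerInfty κ ⊓ ⨅ σ : absoluteGaloisGroup ℚ,
          (localKummerOverOfEmb W p κ.kerSubgroup (closureEmb (K := ℚ) ℚ_[p])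
            (⨆ n, strictSignedLocalPoints κ ℚ_[p] W 1 n)).comap
              (W.conjH1 p κ.kerSubgroup σ)).comap (W.layerToInfty κ 0) ⊓
        AddSubgroup.torsionBy (W.subgroupH1 p (κ.layerSubgroup 0)) ((p ^ m : ℕ) : ℤ)) := by
  set v₀ := (Rat.HeightOneSpectrum.primesEquiv (R := 𝓞 ℚ)).symm ⟨p, hp.out⟩ with hv₀def
  -- abbreviations
  set 𝓚 : SelmerStructure (W.torsionGaloisModule ((p ^ m : ℕ) : ℤ)) :=
    W.kummerSelmerStructure ((p ^ m : ℕ) : ℤ) with h𝓚def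
  set Sig : AddSubgroup (W.subgroupH1 p (κ.layerSubgroup 0)) := (⨅ σ : absoluteGaloisGroup ℚ,
    (localKummerOverOfEmb W p κ.kerSubgroup (closureEmb (K := ℚ) ℚ_[p])
      (⨆ n, strictSignedLocalPoints κ ℚ_[p] W 1 n)).comap (W.conjH1 p κ.kerSubgroup σ)).comap
    (W.layerToInfty κ 0) with hSig
  set A₀ : AddSubgroup (W.subgroupH1 p (κ.layerSubgroup 0)) := (W.selmerInfty κ ⊓
      ⨅ σ : absoluteGaloisGroup ℚ,
        (localKummerOverOfEmb W p κ.kerSubgroup (closureEmb (K := ℚ) ℚ_[p])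
          (⨆ n, strictSignedLocalPoints κ ℚ_[p] W 1 n)).comap
            (W.conjH1 p κ.kerSubgroup σ)).comap (W.layerToInfty κ 0) with hA₀
  have hA₀eq : A₀ = W.selmerInftyPreimage κ 0 ⊓ Sig := by
    rw [hA₀, AddSubgroup.comap_inf]
    rfl
  set A' : AddSubgroup (W.subgroupH1 p (κ.layerSubgroup 0)) :=
    A₀ ⊓ AddSubgroup.torsionBy (W.subgroupH1 p (κ.layerSubgroup 0)) ((p ^ m : ℕ) : ℤ) with hA'
  -- places: `p ∈ w ↔ w = v₀`
  have hpw : ∀ w : HeightOneSpectrum (𝓞 ℚ), w ≠ v₀ → (p : 𝓞 ℚ) ∉ w.asIdeal := fun w hw h ↦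
    hw ((natCast_mem_asIdeal_iff_eq_primesEquiv_symm w hp.out).mp h)
  have hpT' : ∀ w ∈ T, (p : 𝓞 ℚ) ∉ w.asIdeal := fun w hw ↦ hpw w fun h ↦ hpT (h ▸ hw)
  -- (Γ) `W[p^∞]^{Γ_ℚ} = 0` from `W[p^∞]^{Gal(ℚ̄/ℚ_∞)} = 0` (x1b file 55), and divisibility
  obtain ⟨M₀, hΔ, hA, hVM₀⟩ := exists_goodSupersingularPadicModel hp2 V hgood hap
  have hc := sq_ne_neg_one_pow_mul_prime hp.out (p / 2)
  have hΓ : ∀ Q : W.geomPrimaryTorsion p,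
      (∀ σ : absoluteGaloisGroup ℚ, X11b.LocBridge.primaryGaloisModule W p σ Q = Q) → Q = 0 := by
    intro Q hQ
    have hmem : Q ∈ FixedPoints.addSubgroup κ.kerSubgroup (W.geomPrimaryTorsion p) := by
      rw [FixedPoints.mem_addSubgroup]
      intro σ
      exact hQ σ
    rw [fixedPoints_kerSubgroup_geomPrimaryTorsion_eq_bot_of_quadraticTwist κ hp2 W hc Cv hCV M₀ hΔ hA
      hVM₀] at hmem
    exact (AddSubgroup.mem_bot).mp hmem
  have hdiv : W.zsmul_geomPoints_surjective := W.zsmul_geomPoints_surjective_holds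
  -- the tower structure `𝓣` on `W[p^m]`, as an explicit term
  let 𝓣 : SelmerStructure (W.torsionGaloisModule ((p ^ m : ℕ) : ℤ)) := fun v ↦
    match v with
    | Sum.inl w => W.kummerSelmerStructure ((p ^ m : ℕ) : ℤ) (Sum.inl w)
    | Sum.inr v => (W.localTowerKer κ (v.adicCompletion ℚ) 0).comap
        ((resH1Hom (Literature.NumberTheory.EllipticCurves.subgroupIncl
            (localSubgroup (κ.layerSubgroup 0) (v.adicCompletion ℚ)))
          (AddMonoidHom.id (localPoints W (v.adicCompletion ℚ))) (fun _ _ ↦ rfl)).comp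
          (galoisCohomology.map
            (W.torsionPointsMapIntertwining ((p ^ m : ℕ) : ℤ) (v.adicCompletion ℚ)) 1))
  have h𝓣fin : ∀ v : HeightOneSpectrum (𝓞 ℚ), 𝓣 (Sum.inr v) =
      (W.localTowerKer κ (v.adicCompletion ℚ) 0).comap
        ((resH1Hom (Literature.NumberTheory.EllipticCurves.subgroupIncl
            (localSubgroup (κ.layerSubgroup 0) (v.adicCompletion ℚ)))
          (AddMonoidHom.id (localPoints W (v.adicCompletion ℚ))) (fun _ _ ↦ rfl)).comp
          (galoisCohomology.map
            (W.torsionPointsMapIntertwining ((p ^ m : ℕ) : ℤ) (v.adicCompletion ℚ)) 1)) := fun _ ↦ rfl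
  have h𝓣inf : ∀ w : InfinitePlace ℚ, 𝓣 (Sum.inl w) = W.kummerSelmerStructure ((p ^ m : ℕ) : ℤ) (Sum.inl w) :=
    fun _ ↦ rfl
  have hT0 : ∀ v : HeightOneSpectrum (𝓞 ℚ), v ∉ T → v ≠ v₀ →
      W.localTowerKerPrimary κ (v.adicCompletion ℚ) 0 = ⊥ := fun v hv hne ↦
    localTowerKerPrimary_eq_bot_of_not_dvd_localTamagawaNumber W hκ (hpw v hne) fun hd ↦ hv (hT v hne hd)
  -- the structure `𝓖 = 𝓣[v₀ ↦ 𝓣_{v₀} ⊓ 𝓚_{v₀}]`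
  set 𝓖 : SelmerStructure (W.torsionGaloisModule ((p ^ m : ℕ) : ℤ)) :=
    Function.update 𝓣 (Sum.inr v₀) (𝓣 (Sum.inr v₀) ⊓ 𝓚 (Sum.inr v₀)) with h𝓖
  -- ctrl's §1 at `v₀`
  have hL1 := localization_mem_kummer_iff_levelToLayerZero_mem_localKummer_zero W p κ m v₀ rfl
  -- (α) `c ∈ H¹_𝓖 ↔ Ψ_m c ∈ A₀⁺`
  have hiffA : ∀ c, c ∈ 𝓖.selmerGroup ↔
      resH1Hom (Literature.NumberTheory.EllipticCurves.subgroupIncl (κ.layerSubgroup 0)) (AddMonoidHom.id (geomPrimaryTorsion W p))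
        (fun _ _ ↦ rfl) (galoisCohomology.map (primaryInclusion W p m) 1 c) ∈ A₀ := by
    intro c
    rw [hA₀eq, h𝓖]
    refine mem_selmerGroup_update_inf_iff_levelToLayerZero_mem_inf W p κ m 𝓣 (W.selmerInftyPreimage κ 0)
      (mem_selmerGroup_iff_levelToLayerZero_mem_selmerInftyPreimage W p κ m 𝓣 h𝓣fin h𝓣inf)
      (Sum.inr v₀) (𝓚 (Sum.inr v₀)) Sig (fun c hc ↦ ⟨fun h ↦ ?_, fun h ↦ ?_⟩) c
    · exact mem_plusSig_of_mem_localKummer_zero W p κ _ ((hL1 c).mp h)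
    · refine (hL1 c).mpr (evenBranchPlusLocalControlZeroAt_holds W p V Cv hp2 hCV hgood hap κ hκ _ ?_)
      rw [AddSubgroup.comap_inf]
      exact ⟨hc, h⟩
  -- (α') `c ∈ H¹_𝓖 ↔ Ψ_m c ∈ A₀⁺[p^m]` (every `Ψ_m c` is killed by `p^m`)
  have hiffA' : ∀ c, c ∈ 𝓖.selmerGroup ↔
      resH1Hom (Literature.NumberTheory.EllipticCurves.subgroupIncl (κ.layerSubgroup 0)) (AddMonoidHom.id (geomPrimaryTorsion W p))
        (fun _ _ ↦ rfl) (galoisCohomology.map (primaryInclusion W p m) 1 c) ∈ A' := by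
    intro c
    rw [hiffA c, hA', AddSubgroup.mem_inf, AddSubgroup.torsionBy.nsmul_iff]
    exact ⟨fun h ↦ ⟨h, pow_smul_levelToLayerZero_eq_zero W p κ m c⟩, fun h ↦ h.1⟩
  have hA'm : ∀ z ∈ A', p ^ m • z = 0 := fun z hz ↦
    AddSubgroup.torsionBy.nsmul_iff.mp (AddSubgroup.mem_inf.mp hz).2
  -- `𝓖 ⊇ 𝓚` at `T`, `𝓖 = 𝓚` off `T`
  have hv₀ne : ∀ w ∈ T, (Sum.inr w : Place ℚ) ≠ Sum.inr v₀ := fun w hw h ↦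
    hpT ((Sum.inr_injective h) ▸ hw)
  have h𝓖T : ∀ w ∈ T, 𝓚 (Sum.inr w) ≤ 𝓖 (Sum.inr w) := fun w hw ↦ by
    rw [h𝓖, Function.update_of_ne (hv₀ne w hw), h𝓣fin w]
    exact kummerSelmerStructure_inr_le_comap_localTowerKer W p κ m w
  have h𝓖eqT : ∀ w ∈ T, 𝓖 (Sum.inr w) = 𝓣 (Sum.inr w) := fun w hw ↦ by
    rw [h𝓖, Function.update_of_ne (hv₀ne w hw)]
  have h𝓖off : ∀ v : Place ℚ, (∀ w ∈ T, v ≠ Sum.inr w) → 𝓖 v = 𝓚 v := by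
    intro v hv
    by_cases hv0 : v = Sum.inr v₀
    · subst hv0
      rw [h𝓖, Function.update_self, inf_eq_right, h𝓣fin v₀]
      exact kummerSelmerStructure_inr_le_comap_localTowerKer W p κ m v₀
    · rw [h𝓖, Function.update_of_ne hv0]
      refine eq_kummerSelmerStructure_of_not_mem W p κ m 𝓣 h𝓣fin h𝓣inf (↑T ∪ {v₀}) (fun v' hv' ↦ ?_) v
        (fun w hw ↦ ?_)
      · simp only [Set.mem_union, Finset.mem_coe, Set.mem_singleton_iff, not_or] at hv'
        exact hT0 v' hv'.1 hv'.2
      · rcases hw with hw | hw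
        · exact hv w hw
        · rw [Set.mem_singleton_iff.mp hw]; exact hv0
  -- §1 and the level bridge `#H¹_𝓖 = #A₀⁺[p^m]`
  have hcount := prod_relIndex_dvd_natCard_selmerGroup W p m hm hPT T 𝓖 h𝓖T h𝓖off
  rw [natCard_selmerGroup_eq_of_iff W p κ m hdiv hΓ 𝓖 A' hA'm hiffA'] at hcount
  -- the local factors (x1b file 75, B4)
  have hloc : ∀ w ∈ T, (W.kummerSelmerStructure ((p ^ m : ℕ) : ℤ) (Sum.inr w)).relIndex (𝓖 (Sum.inr w)) =
      p ^ padicValNat p ((W.baseChange (w.adicCompletion ℚ)).localTamagawaNumber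
        (w.adicCompletionIntegers ℚ)) := fun w hw ↦ by
    obtain ⟨δ, hδ⟩ := Greenberg1999.exists_apply_resGal_ne_one_of_isCyclotomic hκ w
    rw [h𝓖eqT w hw]
    exact relIndex_kummer_comap_localTowerKer_eq_pow_padicValNat_localTamagawaNumber W p κ m (hpT' w hw)
      ⟨δ, fun h ↦ hδ (ZpExtension.mem_kerSubgroup.mp h)⟩ (hTm w hw)
  rw [Finset.prod_congr rfl hloc] at hcount
  rw [hA', hA₀] at hcount
  exact hcount

end Twist


end TamagawaRoad

end Summit.BirchSwinnertonDyer.BirchSwinnertonDyer.Theorems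

end
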